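import Summits.BirchSwinnertonDyer.BirchSwinnertonDyer.Theorems.WildThreeRankOneBSDpOfShaCertificateKatoTwist
import Summits.BirchSwinnertonDyer.BirchSwinnertonDyer.Theorems.RankLeOneBSDpOfGlobalDivisibilityCertificate
import Literature.NumberTheory.EllipticCurves.MatarNekovar2019.ShaStructureIrreducible
import HarnessLib

/-!
# W-ALL row 2·3@3, INDEX-EXCESS rows in CERTIFICATE currency WITHOUT K9's L₀: one Kolyvagin NON-divisibility
# certificate at depth `ord₃ ∏_ℓ c_ℓ(E) + v₃(c) + 1` + a `3`-descent certificate on `E` + Kato on the rank-zero twist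
# ⟹ exact sockets ⟹ `BSD₃(E^{d_K})` and `BSD₃(E)` (route-free class theorem; cell `bsd-wall`, D-0131 (3) M-UTD,
# seat `bsd-wall-utd-p3` gen 4; `--supports stmt-BirchSwinnertonDyer-20387`)

Context. Gen 3's certificate road (`WildThreeRankOneBSDpOfShaCertificateKatoTwist.lean`, p575247) closes the JET-exact rows
(`e = 0`) of the onto wild rank-one leaf at `3` from print + data, and the INDEX-EXCESS rows (`ord₃[E(K):ℤP] = t + v₃(c) + e`,
`e ≥ 1`, `ord₃ Ш_an(E^{d_K}) = 2e`; ≈ 472 onto-W r1 residue classes, census BLOCK-A T17) from print + data + ONE research input,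
K9's LOWER half L₀ `WildLowerHalfRankZero` at the twist. THIS file removes L₀ there: the LOWER socket over `K`
(`2·ord₃[E(K):ℤP] ≤ ord₃ #Ш(E/K) + 2t + 2v₃(c)`, i.e. `ord₃ #Ш(E/K) ≥ 2e`) is read off ONE KOLYVAGIN CERTIFICATE — a derived
Heegner point `P_n` on the frame `(Dt, H.β, ι)` at a square-free product of Kolyvagin primes of index `≥ t + v₃(c) + 1` with
`P_n ∉ 3^{t+v₃(c)+1}·E(K[n])` — through the LOWER half of Kolyvagin's structure theorem (Matar–Nekovář 2019 Thm. 0.7 read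
through §0.11, tree fact `MatarNekovar2019.thm07_pow_dvd_card_sha_primary_of_certificate_of_irreducible`: such a certificate at
depth `M + 1` forces `3^{2(M₀ − M)} ∣ #Ш(E/K)[3^∞]`, no reduction binder at `3`). This is the kernel face of the numerical road of
Jetchev–Lauter–Stein 2009 (Kolyvagin classes certify NON-trivial `Ш`), here used to certify `#Ш(E^{d_K})[3^∞] = 3^{2e}` exactly.

* §1 (generic odd `p`, `ρ̄_{E,p}` irreducible, `E` non-CM, any reduction type)
  `lower_of_kolyvaginCertificate_of_irr` — ONE certificate at depth `ord_p ∏_ℓ c_ℓ(E) + s + 1` ⟹ the LOWER socket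
  `IndexLowerBoundLeAt W p K P s` (STEP L at slack `s`; rank one and `Ш(E/K)` finite from `kolyvagin`, `ord_p[E(K):ℤP] = M₀` by
  McCallum's Lemma 5.1 bookkeeping as in soed-p2's `WildSigmaDivisibilityAtThreeOfKo.globalDivisibility_of_upper_of_surj`).
* §2 (`p = 3`, the wild row) `bsdp_three_of_indexExcess_of_shaTrivial_of_katoTam_of_kolyvaginCertificate` — gen 3's §2 with
  L₀ REPLACED by the certificate: `ClassO6 W 3`, `r_an = 1`, `3`-adic tower onto (for Kato at the twist), ONE Heegner datum
  (odd `d_K`, `d_K ≠ −3`, `L(E^{d_K},1) ≠ 0`), `ord₃[E(K):ℤP] = t + v₃(c) + e`, `ord₃ #Ш(E) = 0` (3-descent certificate),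
  `ord₃ Ш_an(Wd) = 2e` (exact rational datum), ONE Kolyvagin certificate at depth `t + v₃(c) + 1`: {GZ, Kolyvagin, GZK,
  modularity, GZ86 I.(7.3), Kato A161″, MN19 Thm. 0.7 lower half} (named) ⟹ `BSDp W 3`. Steps: Kato ⟹ `ord₃ #Ш(Wd) ≤ 2e`;
  Dokchitser² Lemma 4.14 + `Ш(E)[3^∞] = 0` ⟹ `ord₃ #Ш(E/K) = ord₃ #Ш(Wd) ≤ 2e`; §1 ⟹ `ord₃ #Ш(E/K) ≥ 2e`; hence both halves of
  the twist (`BSDp Wd 3` by `bsdp_of_missingPPartAt`) and both sockets at slack `v₃(c)`; gen 0 §4 concludes.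

HONEST FRAMING: CERTIFICATE currency — `hI`, `hShaE` (a `3`-descent computation), `hShaAnD` (modular symbols) and `hcert`
(a Kolyvagin-class computation à la Jetchev–Lauter–Stein, finite but expensive) are per-class data, so by the cell's rules this
closes no W-ALL class; it is the kernel consumer that makes the INDEX-EXCESS certificate road RESEARCH-FREE (no L₀, no IMC, no J).
CONDITIONAL on the named facts; «beyond-print theorem»: NO. BSD is not proved for any curve by this file. No definition, no
named fact, no `sorry`.
References: [MatarNekovar2019] Thm. 0.7 (p. 456), §0.11 (p. 457); [McCallumLMS1991] §5 Lemma 5.1, Cor. 5.6 (p. 310);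
[JetchevLauterStein2009] §1; [DokchitserDokchitserAnnals2010] Lemma 4.14; [Kato2004Asterisque] Thm. 14.5 (3);
[JetchevSkinnerWan2017] §7.4.1; [GrossZagier1986] I.(6.3), I.(7.3).
-/

noncomputable section

open scoped Classical

set_option linter.dupNamespace false
set_option autoImplicit false

namespace Summit.BirchSwinnertonDyer.BirchSwinnertonDyer.Theorems.SchneiderFree.Exact

open WeierstrassCurve NumberField IsDedekindDomain Field
  Literature.NumberTheory.EllipticCurves
  Literature.NumberTheory.EllipticCurves.ModularForms
  Literature.NumberTheory.EllipticCurves.Rank1Residual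
  Literature.NumberTheory.EllipticCurves.Rank1Residual.Typed
  Literature.NumberTheory.EllipticCurves.KrizLi2019
  Summit.BirchSwinnertonDyer.Rank1Residual
  Summit.BirchSwinnertonDyer.Rank1Residual.Additive
  Summit.BirchSwinnertonDyer.Rank1Residual.X11b
  Summit.BirchSwinnertonDyer.Rank1Residual.X11b.Three
  Summit.BirchSwinnertonDyer.BirchSwinnertonDyer.Theorems.UniversalToricDescentWaldspurgerFlat
  Summit.BirchSwinnertonDyer.BirchSwinnertonDyer.Theses.KatoDescentPotSupersingular

/-! ### §1 One Kolyvagin NON-divisibility certificate ⟹ the LOWER socket (generic odd `p`, irreducible image) -/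

/-- **Kolyvagin certificate ⟹ STEP L at slack `s`.** For `W/ℚ` globally minimal non-CM, `p` an odd prime with `E[p]`
irreducible, `K` imaginary quadratic Heegner for `N_E` with `d_K ∉ {−3, −4}`, a frame `(Dt, H, ι)` and `P ∈ E(K)` with
`ι(P) = heegnerPointComplex Dt H` of infinite order: ONE derived Heegner point `P_n` on the frame `(Dt, H.β, ι)` (`n` square-free,
every `ℓ ∣ n` a Kolyvagin prime of index `≥ ord_p ∏_ℓ c_ℓ(E) + s + 1`) that is NOT `p^{ord_p ∏c + s + 1}`-divisible in `E(K[n])`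
gives `IndexLowerBoundLeAt W p K P s`, i.e. `2·ord_p[E(K):ℤP] ≤ ord_p #Ш(E/K) + 2·ord_p ∏_ℓ c_ℓ(E) + 2s` — by the LOWER half
of Kolyvagin's structure theorem (`hMNlow`: the certificate forces `p^{2(M₀ − M)} ∣ #Ш(E/K)[p^∞]`, `M = ord_p ∏c + s`) and
`ord_p[E(K):ℤP] = M₀` (rank one from `kolyvagin`, `E(K)[p] = 0` from irreducibility). CONDITIONAL on `hKo`, `hMNlow` (named).
[cite: MatarNekovar2019, Thm. 0.7 (p. 456) and §0.11 (p. 457)] [cite: McCallumLMS1991, §5 Lemma 5.1 and Cor. 5.6 (p. 310)] -/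
theorem lower_of_kolyvaginCertificate_of_irr
    (hKo : ∀ (N : ℕ) [NeZero N] (W : WeierstrassCurve ℚ) (K : Type) [Field K] [NumberField K],
      kolyvagin N W K)
    (hMNlow : MatarNekovar2019.thm07_pow_dvd_card_sha_primary_of_certificate_of_irreducible)
    (W : WeierstrassCurve ℚ) [W.IsElliptic] [W.IsGloballyMinimal] [NeZero (W.conductorNorm ℤ)]
    (hCM : ¬ W.HasCM) (p : ℕ) [Fact p.Prime] (hp2 : p ≠ 2) (hirr : W.HasIrreducibleModPGaloisRep p)
    (K : Type) [Field K] [NumberField K] (hK : IsImaginaryQuadratic K)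
    (h3 : NumberField.discr K ≠ -3) (h4 : NumberField.discr K ≠ -4)
    (hHH : SatisfiesHeegnerHypothesis (W.conductorNorm ℤ) K)
    (Dt : ModularParametrizationData W (W.conductorNorm ℤ))
    (H : HeegnerDatum (W.conductorNorm ℤ) (NumberField.discr K)) (ι : K →+* ℂ)
    (P : (W.baseChange K).toAffine.Point)
    (hP : WeierstrassCurve.Affine.Point.map ι.toRatAlgHom P = heegnerPointComplex Dt H)
    (hnt : ¬ IsOfFinAddOrder P) {s : ℕ}
    (hcert : ∃ (n : ℕ) (d : KolyvaginHeegnerData Dt H.β ι n), Squarefree n ∧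
      (∀ ℓ ∈ n.primeFactors, Zhang2014.IsKolyvaginPrime (W.conductorNorm ℤ) W K p ℓ ∧
        padicValNat p W.tamagawaProduct + s + 1 ≤ Zhang2014.kolyvaginIndex W p ℓ) ∧
      ¬ Koly.PDiv d p (padicValNat p W.tamagawaProduct + s + 1)) :
    IndexLowerBoundLeAt W p K P s := by
  have hp : p.Prime := Fact.out
  obtain ⟨n, d, hn, hkol, hnd⟩ := hcert
  -- rank one and `Ш(E/K)` finite (Kolyvagin); no `p`-torsion in `E(K)` (irreducible image)
  obtain ⟨hrank, hfin⟩ := hKo (W.conductorNorm ℤ) W K hK hHH ⟨Dt, H, ι, hP⟩ hnt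
  haveI : Finite (W.baseChange K).sha := hfin
  have hbot := torsionBy_eq_bot_of_isImaginaryQuadratic_of_hasIrreducibleModPGaloisRep W K hK hp hirr
  have hiv : ∀ x : (W.baseChange K).toAffine.Point, p • x = 0 → x = 0 := fun x hx ↦ by
    have hmem : x ∈ AddSubgroup.torsionBy (W.baseChange K).toAffine.Point ((p : ℕ) : ℤ) := by
      rw [mem_torsionBy_iff, natCast_zsmul]
      exact hx
    rw [hbot] at hmem
    exact hmem
  -- the conductor-`1` datum and `P(1) ↦ P` (Darmon Thm. 3.6, Shimura reciprocity at conductor `1`)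
  obtain ⟨d₁⟩ := exists_kolyvaginHeegnerData_one
    (phi_heegnerTau_mem_singularModuliField_holds (W.conductorNorm ℤ) W K) hK Dt H.β ι H.dvd_sq_sub
  have hPd : d₁.toGeomPoints d₁.derivedPoint = toGeomPoints (W.baseChange K) P :=
    KolyvaginBottom.toGeomPoints_derivedPoint_one_eq
      (heegnerPointOfConductor_one_galoisConj_holds (W.conductorNorm ℤ) W K) hK hHH hP d₁ rfl
  -- `p^{M₀} ∥ P` in `E(K)` (Mordell–Weil)
  haveI : Module.Finite ℤ (W.baseChange K).toAffine.Point := (W.baseChange K).module_finite_point_holds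
  obtain ⟨M₀, x₀, hx₀, hmax⟩ := exists_pow_smul_eq_and_forall_ne hnt (p := p) hp.two_le
  have hdiv : ∃ Q : (W.baseChange K).toAffine.Point, ((p ^ M₀ : ℕ) : ℤ) • Q = P :=
    ⟨x₀, by rw [natCast_zsmul]; exact hx₀⟩
  have hndiv : ¬ ∃ Q : (W.baseChange K).toAffine.Point, ((p ^ (M₀ + 1) : ℕ) : ℤ) • Q = P := by
    rintro ⟨Q, hQ⟩
    exact hmax Q (by rw [← natCast_zsmul]; exact hQ)
  -- the certificate forces `p^{2(M₀ − M)} ∣ #Ш(E/K)[p^∞]`, `M := ord_p ∏c + s` (structure theorem, LOWER half)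
  have hdvd := hMNlow W hCM K hK h3 h4 hHH p hp2 hirr Dt H.β ι d₁ P hPd hnt M₀ hdiv hndiv n
    (padicValNat p W.tamagawaProduct + s) d hn hkol hnd
  have hcard : Nat.card (AddCommGroup.primaryComponent (W.baseChange K).sha p) ≠ 0 := Nat.card_pos.ne'
  have hle : 2 * (M₀ - (padicValNat p W.tamagawaProduct + s)) ≤
      padicValNat p (Nat.card (AddCommGroup.primaryComponent (W.baseChange K).sha p)) :=
    (padicValNat_dvd_iff_le hcard).mp hdvd
  -- bookkeeping: `ord_p #Ш(E/K) = ord_p #Ш(E/K)[p^∞]`, `ord_p [E(K):ℤP] = M₀`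
  have hsha : padicValNat p (W.baseChange K).shaOrder =
      padicValNat p (Nat.card (AddCommGroup.primaryComponent (W.baseChange K).sha p)) :=
    Koly.padicValNat_shaOrder_eq (W.baseChange K) p
  haveI : Finite (AddCommGroup.torsion (W.baseChange K).toAffine.Point) :=
    WeierstrassCurve.finite_torsion_point (W := W.baseChange K)
  obtain ⟨c, Q, hcQ, hcker⟩ := RankOne.exists_coord_of_mordellWeilRank_eq_one (W.baseChange K) hrank
  have hidx : padicValNat p (AddSubgroup.zmultiples P).index = M₀ :=
    Koly.padicValNat_index_zmultiples_eq_of_divisibility c Q hcQ hcker hiv P hdiv hndiv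
  unfold IndexLowerBoundLeAt
  rw [hidx, hsha]
  omega

/-! ### §2 INDEX-EXCESS rows at the wild `3`: the certificate replaces K9's L₀ -/

/-- **INDEX-EXCESS, research-free certificate road: `Ш(E)[3^∞]` trivial + `ord₃ Ш_an(E^{d_K}) = 2e` + Kato above the twist +
ONE Kolyvagin NON-divisibility certificate ⟹ `BSD₃(E)`.** For `E` (globally minimal `W`) on `ClassO6 W 3` with `r_an = 1`,
`ρ_{E,3^n}` onto for every `n`, ONE Heegner datum `(K, Dt, H, ι, P)` at level `N_E` (odd `d_K ≠ −3`, Heegner hypothesis,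
`L(E^{d_K},1) ≠ 0`, `P = y_K`), a globally minimal model `Wd` of `E^{d_K}`, `ord₃[E(K):ℤP] = ord₃ ∏_ℓ c_ℓ + v₃(c) + e` (`hI`),
`ord₃ #Ш(E) = 0` (`hShaE`, `3`-descent certificate), `ord₃ Ш_an(Wd) = 2e` (`hShaAnD`), and ONE derived Heegner point on the
frame at Kolyvagin primes of index `≥ ord₃ ∏c + v₃(c) + 1` that is not `3^{ord₃ ∏c + v₃(c) + 1}`-divisible (`hcert`):
{GZ, Kolyvagin, GZK, modularity, GZ86 I.(7.3), Kato A161″, Matar–Nekovář Thm. 0.7 lower half} (named) ⟹ `BSDp W 3`. Kato bounds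
`ord₃ #Ш(Wd) ≤ 2e`; `Ш(E/K)[3^∞] = Ш(E)[3^∞] ⊕ Ш(Wd)[3^∞]` (Dokchitser² 4.14) and `hShaE` give `ord₃ #Ш(E/K) ≤ 2e`; §1 gives
`≥ 2e`; so both halves at the twist and both sockets at slack `v₃(c)` hold, and gen 0 §4 concludes. NO L₀, NO main conjecture,
NO Σ-divisibility. CERTIFICATE currency: closes no class by the cell's rules. [cite: MatarNekovar2019, Thm. 0.7 (p. 456) and §0.11 (p. 457)]
[cite: DokchitserDokchitserAnnals2010, Lemma 4.14] [cite: Kato2004Asterisque, Thm. 14.5 (3) (p. 236)]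
[cite: JetchevSkinnerWan2017, §7.4.1 (arXiv:1512.06894 p. 30)] [cite: GrossZagier1986, Thm. I.(6.3) and (7.3)] -/
theorem bsdp_three_of_indexExcess_of_shaTrivial_of_katoTam_of_kolyvaginCertificate
    (hGZ : ∀ (N : ℕ) [NeZero N] (W : WeierstrassCurve ℚ) (K : Type) [Field K] [NumberField K],
      gross_zagier N W K)
    (hKo : ∀ (N : ℕ) [NeZero N] (W : WeierstrassCurve ℚ) (K : Type) [Field K] [NumberField K],
      kolyvagin N W K)
    (hGZK : rank_eq_analyticRank_of_analyticRank_le_one) (hmod : hasEntireLFunction_rat)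
    (hGZ73 : GrossZagier1986_thm_I_7_3)
    (hKatoT : Kato2004.rankZero_padicValNat_sha_add_padicValNat_tamagawa_le_of_additive_potGood_of_imageContainsSL2)
    (hMNlow : MatarNekovar2019.thm07_pow_dvd_card_sha_primary_of_certificate_of_irreducible)
    (W : WeierstrassCurve ℚ) [W.IsElliptic] [W.IsGloballyMinimal] [NeZero (W.conductorNorm ℤ)]
    (hO6 : ClassO6 W 3) (hρ : ∀ n : ℕ, W.HasSurjectiveModNGaloisRep (3 ^ n : ℕ)) (hr : W.analyticRank = 1)
    (K : Type) [Field K] [NumberField K]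
    (Dt : ModularParametrizationData W (W.conductorNorm ℤ))
    (H : HeegnerDatum (W.conductorNorm ℤ) (NumberField.discr K)) (ι : K →+* ℂ)
    (P : (W.baseChange K).toAffine.Point) (Wd : WeierstrassCurve ℚ) [Wd.IsElliptic] [Wd.IsGloballyMinimal]
    (hK : IsImaginaryQuadratic K) (hodd : Odd (NumberField.discr K)) (hd3 : NumberField.discr K ≠ -3)
    (hHH : SatisfiesHeegnerHypothesis (W.conductorNorm ℤ) K)
    (hLd : (W.quadraticTwist (NumberField.discr K : ℚ)).entireLFunction 1 ≠ 0)
    (hP : WeierstrassCurve.Affine.Point.map ι.toRatAlgHom P = heegnerPointComplex Dt H)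
    (hC : ∃ C : VariableChange ℚ, C • W.quadraticTwist (NumberField.discr K : ℚ) = Wd)
    {e : ℕ} (hI : padicValNat 3 (AddSubgroup.zmultiples P).index =
      padicValNat 3 W.tamagawaProduct + padicValNat 3 Dt.c.natAbs + e)
    (hShaE : padicValNat 3 W.shaOrder = 0)
    (hShaAnD : ∃ q : ℚ, shaAn Wd = (q : ℂ) ∧ padicValRat 3 q = 2 * e)
    (hcert : ∃ (n : ℕ) (d : KolyvaginHeegnerData Dt H.β ι n), Squarefree n ∧
      (∀ ℓ ∈ n.primeFactors, Zhang2014.IsKolyvaginPrime (W.conductorNorm ℤ) W K 3 ℓ ∧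
        padicValNat 3 W.tamagawaProduct + padicValNat 3 Dt.c.natAbs + 1 ≤ Zhang2014.kolyvaginIndex W 3 ℓ) ∧
      ¬ Koly.PDiv d 3 (padicValNat 3 W.tamagawaProduct + padicValNat 3 Dt.c.natAbs + 1)) :
    BSDp W 3 := by
  haveI : Fact (3 : ℕ).Prime := ⟨by norm_num⟩
  have hsurj : W.HasSurjectiveModNGaloisRep 3 := by simpa using hρ 1
  have hCM : ¬ W.HasCM := fun hCM ↦ W.not_hasSurjectiveModNGaloisRep_of_hasCM hCM Nat.prime_three (by norm_num) hsurj
  have hirr : W.HasIrreducibleModPGaloisRep 3 :=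
    hasIrreducibleModPGaloisRep_of_hasSurjectiveModNGaloisRep W 3 hsurj
  have hd4 : NumberField.discr K ≠ -4 := by
    intro h; rw [h] at hodd; exact (by decide : ¬ Odd (-4 : ℤ)) hodd
  have h3N : 3 ∣ W.conductorNorm ℤ :=
    (W.dvd_conductorNorm_iff_not_hasGoodReductionAtPrime 3).mpr (not_good_of_addv W 3 hO6.2.1)
  have hw : ¬ 3 ∣ Units.torsionOrder K :=
    (X11b.Three.not_dvd_discr_and_not_dvd_torsionOrder_of_heegner hK hHH (by decide) h3N).2
  -- the Heegner point is non-torsion (Gross–Zagier); `Ш(E/K)` finite (Kolyvagin)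
  have hL0v : W.entireLFunction 1 = 0 := entireLFunction_one_eq_zero_of_analyticRank_eq_one hr
  obtain ⟨-, hderiv⟩ := leadingLCoeff_eq_deriv_of_analyticRank_eq_one hr
  have hLK : LDerivEK W K ≠ 0 := by
    rw [lDerivEK_eq_deriv_mul W K hmod hL0v]; exact mul_ne_zero hderiv hLd
  have hnt : ¬ IsOfFinAddOrder P :=
    (lDerivEK_ne_zero_iff_not_isOfFinAddOrder W (W.conductorNorm ℤ) K (hGZ _ W K) hK hHH
      ⟨Dt, H, ι, hP⟩).mp hLK
  obtain ⟨-, hfinK⟩ := hKo (W.conductorNorm ℤ) W K hK hHH ⟨Dt, H, ι, hP⟩ hnt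
  haveI : Finite (W.baseChange K).sha := hfinK
  -- the twist: O6, rank zero, finite `Ш`; Kato's upper half
  obtain ⟨Cd, hCd⟩ := hC
  obtain ⟨hO6d, -⟩ := classO6_twist_of_heegner W hO6 K hK hHH hodd Wd Cd hCd
  have hD0 : (NumberField.discr K : ℚ) ≠ 0 := by exact_mod_cast NumberField.discr_ne_zero K
  haveI : (W.quadraticTwist (NumberField.discr K : ℚ)).IsElliptic := W.isElliptic_quadraticTwist hD0
  have hLd1 : Wd.entireLFunction 1 ≠ 0 := by rw [← hCd, entireLFunction_smul]; exact hLd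
  have hrd : Wd.analyticRank = 0 := analyticRank_eq_zero_of_entireLFunction_one_ne_zero Wd hLd1
  have hupd : MissingUpperBoundAt Wd 3 :=
    missingUpperBoundAt_twist_of_towerSurj_of_katoTam 3 (by decide) hKatoT hGZK hmod W hO6.2.1
      hO6.padicValRat_j_nonneg hρ rfl K hK hHH Wd ⟨Cd, hCd⟩ hLd
  obtain ⟨-, hfinW⟩ := hGZK W (by rw [hr])
  haveI : Finite W.sha := hfinW
  obtain ⟨-, hfinWd⟩ := hGZK Wd (by rw [hrd]; exact zero_le_one)
  haveI : Finite Wd.sha := hfinWd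
  -- `ord₃ #Ш(Wd) ≤ 2e` (Kato and the datum)
  have hShaD_le : (padicValNat 3 Wd.shaOrder : ℤ) ≤ 2 * e := by
    obtain ⟨q, hq, hv⟩ := hShaAnD
    obtain ⟨q'', hq'', hge⟩ := hupd
    have hqq' : q'' = q := by exact_mod_cast hq''.symm.trans hq
    rw [hqq', hv] at hge
    exact_mod_cast hge
  -- `ord₃ #Ш(E/K) = ord₃ #Ш(E) + ord₃ #Ш(Wd)` (Dokchitser² Lemma 4.14)
  have hprod : Nat.card (AddCommGroup.primaryComponent (W.baseChange K).sha 3) =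
      Nat.card (AddCommGroup.primaryComponent W.sha 3) * Nat.card (AddCommGroup.primaryComponent Wd.sha 3) :=
    card_primaryComponent_sha_baseChange_quadratic_of_odd_of_finite W K hK.1 Wd ⟨Cd, hCd⟩ (W.baseChange K)
      ⟨1, one_smul _ _⟩ 3 (by decide)
  have hshaK : padicValNat 3 (W.baseChange K).shaOrder = padicValNat 3 W.shaOrder + padicValNat 3 Wd.shaOrder := by
    rw [Koly.padicValNat_shaOrder_eq (W.baseChange K) 3, Koly.padicValNat_shaOrder_eq W 3,
      Koly.padicValNat_shaOrder_eq Wd 3, hprod, padicValNat.mul (Nat.card_pos.ne') (Nat.card_pos.ne')]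
  -- the LOWER socket from the Kolyvagin certificate (§1): `ord₃ #Ш(E/K) ≥ 2e`
  have hlo : IndexLowerBoundLeAt W 3 K P (padicValNat 3 Dt.c.natAbs) :=
    lower_of_kolyvaginCertificate_of_irr hKo hMNlow W hCM 3 (by norm_num) hirr K hK hd3 hd4 hHH Dt H ι P hP hnt
      (by simpa only [Nat.add_assoc] using hcert)
  have hlo' : 2 * e ≤ padicValNat 3 Wd.shaOrder := by
    unfold IndexLowerBoundLeAt at hlo; omega
  -- hence `ord₃ #Ш(Wd) = 2e`: the twist's LOWER half, then `BSDp Wd 3`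
  have hShaD : (padicValNat 3 Wd.shaOrder : ℤ) = 2 * e := le_antisymm hShaD_le (by exact_mod_cast hlo')
  have hlowd : MissingLowerBoundAt Wd 3 := by
    obtain ⟨q, hq, hv⟩ := hShaAnD
    exact ⟨q, hq, by rw [hv, hShaD]⟩
  have hWdBSD : BSDp Wd 3 :=
    bsdp_of_missingPPartAt Wd 3 hGZK (by rw [hrd]; exact zero_le_one) (missingPPartAt_of_lower_of_upper Wd 3 hlowd hupd)
  -- the UPPER socket at slack `v₃(c)` (arithmetic), and gen 0 §4
  have hShaDn : padicValNat 3 Wd.shaOrder = 2 * e := by exact_mod_cast hShaD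
  have hup : Upper.IndexUpperBoundLeAt W 3 K P (padicValNat 3 Dt.c.natAbs) := by
    unfold Upper.IndexUpperBoundLeAt; omega
  exact (bsdp_iff_partner_bsdp_of_exactIndexManin hGZ hKo hGZK hmod hGZ73 W 3 (W.conductorNorm ℤ) K Dt H ι P Wd hr rfl
    h3N hK hodd hw hHH hLd hP ⟨Cd, hCd⟩ (by decide) hlo hup).mpr hWdBSD

/-! ### §3 (appended, utd-p3 g4) The SHA3-AN generalisation: `ord₃ #Ш(E) ≤ f`, `ord₃ Ш_an(E^{d_K}) = 2e − f`

§2 is the case `f = 0`. Here part of the index excess is carried by `E` itself (census SHA3-AN rows: 9 onto-W r1 residue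
classes): an UPPER bound `ord₃ #Ш(E) ≤ f` (a `3^∞`-descent datum, e.g. `Ш(E)[3^∞] = Ш(E)[3]` of order `3^f`) replaces
`Ш(E)[3^∞] = 0`; the rank-one `Ш_an(E)` is still never used. -/

/-- **INDEX-EXCESS with part of the excess on `E` (the SHA3-AN rows): a `3^∞`-descent bound `ord₃ #Ш(E) ≤ f` + the datum
`ord₃ Ш_an(Wd) = 2e − f` + Kato above the twist + ONE Kolyvagin NON-divisibility certificate ⟹ `BSD₃(E)`.** Same data and named
facts as §2 (which is the case `f = 0`): Kato gives `ord₃ #Ш(Wd) ≤ 2e − f`, so `ord₃ #Ш(E/K) = ord₃ #Ш(E) + ord₃ #Ш(Wd) ≤ 2e`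
(Dokchitser² Lemma 4.14); the certificate (§1) gives `ord₃ #Ш(E/K) ≥ 2e`; hence `ord₃ #Ш(Wd) = 2e − f` (both halves at the twist,
`BSDp Wd 3`), `ord₃ #Ш(E) = f`, both sockets at slack `v₃(c)`, and gen 0 §4 concludes. NO L₀, NO main conjecture; the rank-one
`Ш_an(E)` is never used (only an UPPER bound `f` on `#Ш(E)[3^∞]`, a descent datum). CERTIFICATE currency; closes no class.
[cite: MatarNekovar2019, Thm. 0.7 (p. 456) and §0.11 (p. 457)] [cite: DokchitserDokchitserAnnals2010, Lemma 4.14]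
[cite: Kato2004Asterisque, Thm. 14.5 (3) (p. 236)] [cite: JetchevSkinnerWan2017, §7.4.1 (arXiv:1512.06894 p. 30)] -/
theorem bsdp_three_of_indexExcess_of_shaLe_of_katoTam_of_kolyvaginCertificate
    (hGZ : ∀ (N : ℕ) [NeZero N] (W : WeierstrassCurve ℚ) (K : Type) [Field K] [NumberField K],
      gross_zagier N W K)
    (hKo : ∀ (N : ℕ) [NeZero N] (W : WeierstrassCurve ℚ) (K : Type) [Field K] [NumberField K],
      kolyvagin N W K)
    (hGZK : rank_eq_analyticRank_of_analyticRank_le_one) (hmod : hasEntireLFunction_rat)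
    (hGZ73 : GrossZagier1986_thm_I_7_3)
    (hKatoT : Kato2004.rankZero_padicValNat_sha_add_padicValNat_tamagawa_le_of_additive_potGood_of_imageContainsSL2)
    (hMNlow : MatarNekovar2019.thm07_pow_dvd_card_sha_primary_of_certificate_of_irreducible)
    (W : WeierstrassCurve ℚ) [W.IsElliptic] [W.IsGloballyMinimal] [NeZero (W.conductorNorm ℤ)]
    (hO6 : ClassO6 W 3) (hρ : ∀ n : ℕ, W.HasSurjectiveModNGaloisRep (3 ^ n : ℕ)) (hr : W.analyticRank = 1)
    (K : Type) [Field K] [NumberField K]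
    (Dt : ModularParametrizationData W (W.conductorNorm ℤ))
    (H : HeegnerDatum (W.conductorNorm ℤ) (NumberField.discr K)) (ι : K →+* ℂ)
    (P : (W.baseChange K).toAffine.Point) (Wd : WeierstrassCurve ℚ) [Wd.IsElliptic] [Wd.IsGloballyMinimal]
    (hK : IsImaginaryQuadratic K) (hodd : Odd (NumberField.discr K)) (hd3 : NumberField.discr K ≠ -3)
    (hHH : SatisfiesHeegnerHypothesis (W.conductorNorm ℤ) K)
    (hLd : (W.quadraticTwist (NumberField.discr K : ℚ)).entireLFunction 1 ≠ 0)
    (hP : WeierstrassCurve.Affine.Point.map ι.toRatAlgHom P = heegnerPointComplex Dt H)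
    (hC : ∃ C : VariableChange ℚ, C • W.quadraticTwist (NumberField.discr K : ℚ) = Wd)
    {e f : ℕ} (hI : padicValNat 3 (AddSubgroup.zmultiples P).index =
      padicValNat 3 W.tamagawaProduct + padicValNat 3 Dt.c.natAbs + e)
    (hShaE : padicValNat 3 W.shaOrder ≤ f)
    (hShaAnD : ∃ q : ℚ, shaAn Wd = (q : ℂ) ∧ padicValRat 3 q + f = 2 * e)
    (hcert : ∃ (n : ℕ) (d : KolyvaginHeegnerData Dt H.β ι n), Squarefree n ∧
      (∀ ℓ ∈ n.primeFactors, Zhang2014.IsKolyvaginPrime (W.conductorNorm ℤ) W K 3 ℓ ∧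
        padicValNat 3 W.tamagawaProduct + padicValNat 3 Dt.c.natAbs + 1 ≤ Zhang2014.kolyvaginIndex W 3 ℓ) ∧
      ¬ Koly.PDiv d 3 (padicValNat 3 W.tamagawaProduct + padicValNat 3 Dt.c.natAbs + 1)) :
    BSDp W 3 := by
  haveI : Fact (3 : ℕ).Prime := ⟨by norm_num⟩
  have hsurj : W.HasSurjectiveModNGaloisRep 3 := by simpa using hρ 1
  have hCM : ¬ W.HasCM := fun hCM ↦ W.not_hasSurjectiveModNGaloisRep_of_hasCM hCM Nat.prime_three (by norm_num) hsurj
  have hirr : W.HasIrreducibleModPGaloisRep 3 :=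
    hasIrreducibleModPGaloisRep_of_hasSurjectiveModNGaloisRep W 3 hsurj
  have hd4 : NumberField.discr K ≠ -4 := by
    intro h; rw [h] at hodd; exact (by decide : ¬ Odd (-4 : ℤ)) hodd
  have h3N : 3 ∣ W.conductorNorm ℤ :=
    (W.dvd_conductorNorm_iff_not_hasGoodReductionAtPrime 3).mpr (not_good_of_addv W 3 hO6.2.1)
  have hw : ¬ 3 ∣ Units.torsionOrder K :=
    (X11b.Three.not_dvd_discr_and_not_dvd_torsionOrder_of_heegner hK hHH (by decide) h3N).2
  have hL0v : W.entireLFunction 1 = 0 := entireLFunction_one_eq_zero_of_analyticRank_eq_one hr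
  obtain ⟨-, hderiv⟩ := leadingLCoeff_eq_deriv_of_analyticRank_eq_one hr
  have hLK : LDerivEK W K ≠ 0 := by
    rw [lDerivEK_eq_deriv_mul W K hmod hL0v]; exact mul_ne_zero hderiv hLd
  have hnt : ¬ IsOfFinAddOrder P :=
    (lDerivEK_ne_zero_iff_not_isOfFinAddOrder W (W.conductorNorm ℤ) K (hGZ _ W K) hK hHH
      ⟨Dt, H, ι, hP⟩).mp hLK
  obtain ⟨-, hfinK⟩ := hKo (W.conductorNorm ℤ) W K hK hHH ⟨Dt, H, ι, hP⟩ hnt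
  haveI : Finite (W.baseChange K).sha := hfinK
  obtain ⟨Cd, hCd⟩ := hC
  obtain ⟨hO6d, -⟩ := classO6_twist_of_heegner W hO6 K hK hHH hodd Wd Cd hCd
  have hD0 : (NumberField.discr K : ℚ) ≠ 0 := by exact_mod_cast NumberField.discr_ne_zero K
  haveI : (W.quadraticTwist (NumberField.discr K : ℚ)).IsElliptic := W.isElliptic_quadraticTwist hD0
  have hLd1 : Wd.entireLFunction 1 ≠ 0 := by rw [← hCd, entireLFunction_smul]; exact hLd
  have hrd : Wd.analyticRank = 0 := analyticRank_eq_zero_of_entireLFunction_one_ne_zero Wd hLd1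
  have hupd : MissingUpperBoundAt Wd 3 :=
    missingUpperBoundAt_twist_of_towerSurj_of_katoTam 3 (by decide) hKatoT hGZK hmod W hO6.2.1
      hO6.padicValRat_j_nonneg hρ rfl K hK hHH Wd ⟨Cd, hCd⟩ hLd
  obtain ⟨-, hfinW⟩ := hGZK W (by rw [hr])
  haveI : Finite W.sha := hfinW
  obtain ⟨-, hfinWd⟩ := hGZK Wd (by rw [hrd]; exact zero_le_one)
  haveI : Finite Wd.sha := hfinWd
  obtain ⟨q, hq, hv⟩ := hShaAnD
  -- Kato and the datum: `ord₃ #Ш(Wd) ≤ v₃ q = 2e − f`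
  have hShaD_le : (padicValNat 3 Wd.shaOrder : ℤ) ≤ padicValRat 3 q := by
    obtain ⟨q'', hq'', hge⟩ := hupd
    have hqq' : q'' = q := by exact_mod_cast hq''.symm.trans hq
    rw [hqq'] at hge
    exact hge
  -- `ord₃ #Ш(E/K) = ord₃ #Ш(E) + ord₃ #Ш(Wd)` (Dokchitser² Lemma 4.14)
  have hprod : Nat.card (AddCommGroup.primaryComponent (W.baseChange K).sha 3) =
      Nat.card (AddCommGroup.primaryComponent W.sha 3) * Nat.card (AddCommGroup.primaryComponent Wd.sha 3) :=
    card_primaryComponent_sha_baseChange_quadratic_of_odd_of_finite W K hK.1 Wd ⟨Cd, hCd⟩ (W.baseChange K)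
      ⟨1, one_smul _ _⟩ 3 (by decide)
  have hshaK : padicValNat 3 (W.baseChange K).shaOrder = padicValNat 3 W.shaOrder + padicValNat 3 Wd.shaOrder := by
    rw [Koly.padicValNat_shaOrder_eq (W.baseChange K) 3, Koly.padicValNat_shaOrder_eq W 3,
      Koly.padicValNat_shaOrder_eq Wd 3, hprod, padicValNat.mul (Nat.card_pos.ne') (Nat.card_pos.ne')]
  -- the LOWER socket from the certificate (§1): `ord₃ #Ш(E/K) ≥ 2e`
  have hlo : IndexLowerBoundLeAt W 3 K P (padicValNat 3 Dt.c.natAbs) :=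
    lower_of_kolyvaginCertificate_of_irr hKo hMNlow W hCM 3 (by norm_num) hirr K hK hd3 hd4 hHH Dt H ι P hP hnt
      (by simpa only [Nat.add_assoc] using hcert)
  have hsum : 2 * e ≤ padicValNat 3 W.shaOrder + padicValNat 3 Wd.shaOrder := by
    unfold IndexLowerBoundLeAt at hlo; omega
  -- hence `ord₃ #Ш(Wd) = v₃ q` and `ord₃ #Ш(E) = f`
  have hShaD : (padicValNat 3 Wd.shaOrder : ℤ) = padicValRat 3 q := by
    have h2 : ((2 * e : ℕ) : ℤ) ≤ (padicValNat 3 W.shaOrder : ℤ) + (padicValNat 3 Wd.shaOrder : ℤ) := by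
      exact_mod_cast hsum
    have h3 : (padicValNat 3 W.shaOrder : ℤ) ≤ (f : ℤ) := by exact_mod_cast hShaE
    push_cast at h2
    omega
  have hlowd : MissingLowerBoundAt Wd 3 := ⟨q, hq, le_of_eq hShaD.symm⟩
  have hWdBSD : BSDp Wd 3 :=
    bsdp_of_missingPPartAt Wd 3 hGZK (by rw [hrd]; exact zero_le_one) (missingPPartAt_of_lower_of_upper Wd 3 hlowd hupd)
  -- the UPPER socket at slack `v₃(c)` (arithmetic), and gen 0 §4
  have hShaDn : padicValNat 3 Wd.shaOrder + f ≤ 2 * e := by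
    have h1 : (padicValNat 3 Wd.shaOrder : ℤ) + f ≤ 2 * e := by rw [hShaD]; exact_mod_cast hv.le
    exact_mod_cast h1
  have hup : Upper.IndexUpperBoundLeAt W 3 K P (padicValNat 3 Dt.c.natAbs) := by
    unfold Upper.IndexUpperBoundLeAt; omega
  exact (bsdp_iff_partner_bsdp_of_exactIndexManin hGZ hKo hGZK hmod hGZ73 W 3 (W.conductorNorm ℤ) K Dt H ι P Wd hr rfl
    h3N hK hodd hw hHH hLd hP ⟨Cd, hCd⟩ (by decide) hlo hup).mpr hWdBSD

end Summit.BirchSwinnertonDyer.BirchSwinnertonDyer.Theorems.SchneiderFree.Exact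

end
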